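import Literature.NumberTheory.ModularSymbols.FullLevelHomologyHeckeProjector
import Mathlib.LinearAlgebra.TensorProduct.RightExactness
import HarnessLib

/-!
# The integral Hecke quasi-projector: base change from `H₁(X₀(N), ℤ)` to `H(N; k)`

Topic `Literature/NumberTheory/ModularSymbols`; namespace `Literature.NumberTheory.ModularSymbols.FullLevel`; sequel of
`FullLevelHomologyHeckeProjector`.  Proved theorems + one `Set` with body; no named fact, no `sorry`, no instance, no notation.

The hypothesis of `multOneHyp_of_heckeProjector` is an element `θ` of `ℤ⟨T_q : q ≠ p⟩ ⊂ End_k H(N; k)` with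
`θ(ker periodClassK f) = 0`, `periodClassK f ∘ θ = c · periodClassK f`.  Its natural INTEGRAL form lives in the Hecke ring
`𝕋 = HeckeRing0 N 2` acting on `Λ_N = H₁(X₀(N), ℤ)` (`periodHomologyHecke N`): `θ₀ ∈ ℤ[T_q : q ≠ p] ⊂ 𝕋` with
`θ₀ · ker(per_f) = 0` and `per_f(θ₀ x) = c · per_f(x)` (`per_f = periodMapLattice N f : Λ_N ↠ Λ_f`).  We prove that the integral
form base-changes to the `k`-form for every commutative ring `k` (right exactness of `k ⊗_ℤ −`, no flatness needed):

* `heckeIntGenSet N p` (the generators `T_q`, `q ≠ p`, of `𝕋`); `hecke_mem_adjoin_heckeGenSet`;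
* `periodClassK_hecke_of_forall` (scaling), `hecke_eq_zero_of_periodClassK_eq_zero` (killing `ker`, via `lTensor_exact`);
* **`multOneHyp_of_intHeckeProjector`**: `MultOneHyp k p M hpM f` from an integral quasi-projector (`12 ∈ kˣ`, `c` regular on
  `k ⊗ Λ_f`).

## References
* J. E. Cremona, *Algorithms for Modular Elliptic Curves* (1997), §2.4 (2.4.1), §2.10 (Hecke action on `H₁(X₀(N), ℤ)`,
  period map). [CremonaAlgorithms1997]
* G. Shimura, *Introduction to the arithmetic theory of automorphic functions* (1971), Thm. 3.41, Thm. 3.51. [Shimura1971]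
-/

noncomputable section

namespace Literature.NumberTheory.ModularSymbols

namespace FullLevel

open scoped MatrixGroups TensorProduct
open CategoryTheory CongruenceSubgroup groupHomology Finsupp Matrix
open Literature.Algebra.Homology
open Literature.NumberTheory.EllipticCurves.ModularForms

/-- The generators `{T_q : q ≠ p prime}` of the integral Hecke ring `𝕋 = HeckeRing0 N 2`. [cite: CremonaAlgorithms1997, §2.4] -/
def heckeIntGenSet (N p : ℕ) [NeZero N] : Set (HeckeRing0 N 2) :=
  {T | ∃ (q : ℕ) (hq : q.Prime), q ≠ p ∧ T = HeckeRing0.T N 2 q hq}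

variable (k : Type) [CommRing k] (p M : ℕ) [Fact p.Prime] (hpM : Nat.Coprime p M) [NeZero M] [NeZero (p ^ 2 * M)]
  [Fintype (diagTorus (ZMod p))] [Invertible (Fintype.card (diagTorus (ZMod p)) : k)]

omit [Fact p.Prime] [NeZero M] [Fintype (diagTorus (ZMod p))] [Invertible (Fintype.card (diagTorus (ZMod p)) : k)] in
/-- `ℤ[T_q : q ≠ p] ⊂ 𝕋` maps into `ℤ⟨T_q : q ≠ p⟩ ⊂ End_k H(p²M; k)` under the Hecke action. [cite: CremonaAlgorithms1997, §2.4 (2.4.1)] -/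
theorem hecke_mem_adjoin_heckeGenSet {θ₀ : HeckeRing0 (p ^ 2 * M) 2}
    (hθ₀ : θ₀ ∈ Algebra.adjoin ℤ (heckeIntGenSet (p ^ 2 * M) p)) :
    hecke (p ^ 2 * M) k θ₀ ∈ Algebra.adjoin ℤ (heckeGenSet k p M) := by
  set φ : HeckeRing0 (p ^ 2 * M) 2 →ₐ[ℤ] Module.End k (CuspidalHomologyHeckeModule (p ^ 2 * M) k) :=
    (hecke (p ^ 2 * M) k).toIntAlgHom with hφ
  have h1 : φ θ₀ ∈ (Algebra.adjoin ℤ (heckeIntGenSet (p ^ 2 * M) p)).map φ := Subalgebra.mem_map.mpr ⟨θ₀, hθ₀, rfl⟩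
  rw [AlgHom.map_adjoin] at h1
  refine Algebra.adjoin_mono ?_ h1
  rintro _ ⟨T, ⟨q, hq, hqp, rfl⟩, rfl⟩
  exact ⟨q, hq, hqp, rfl⟩

omit [Fact p.Prime] [NeZero M] [Fintype (diagTorus (ZMod p))] [Invertible (Fintype.card (diagTorus (ZMod p)) : k)] in
/-- Scaling base-changes: `per_f(θ₀ x) = c·per_f(x)` on `Λ_N` gives `periodClassK f ∘ hecke θ₀ = c · periodClassK f` on `H(N; k)`.
[cite: CremonaAlgorithms1997, §2.10] -/
theorem periodClassK_hecke_of_forall (f : CuspForm (Gamma0 (p ^ 2 * M)) 2) (θ₀ : HeckeRing0 (p ^ 2 * M) 2) (c : ℤ)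
    (hscale₀ : ∀ x : periodHomologyHecke (p ^ 2 * M),
      periodMapLattice (p ^ 2 * M) f (θ₀ • x) = c • periodMapLattice (p ^ 2 * M) f x)
    (w : CuspidalHomologyHeckeModule (p ^ 2 * M) k) :
    periodClassK (p ^ 2 * M) k f (hecke (p ^ 2 * M) k θ₀ w) = (c : k) • periodClassK (p ^ 2 * M) k f w := by
  induction w using TensorProduct.induction_on with
  | zero => simp
  | add x y hx hy => rw [map_add, map_add, hx, hy, map_add, smul_add]
  | tmul r x =>
    rw [hecke_tmul, periodClassK_tmul, periodClassK_tmul, hscale₀, TensorProduct.tmul_smul, Int.cast_smul_eq_zsmul]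

omit [Fact p.Prime] [NeZero M] [Fintype (diagTorus (ZMod p))] [Invertible (Fintype.card (diagTorus (ZMod p)) : k)] in
/-- Killing base-changes: if `θ₀` kills `ker(per_f) ⊂ Λ_N`, then `hecke θ₀` kills `ker(periodClassK f) ⊂ H(N; k)` — by right
exactness of `k ⊗_ℤ −` (`ker(1 ⊗ per_f)` is the image of `k ⊗ ker(per_f)`, `per_f` being onto `Λ_f`). [cite: CremonaAlgorithms1997, §2.10] -/
theorem hecke_eq_zero_of_periodClassK_eq_zero (f : CuspForm (Gamma0 (p ^ 2 * M)) 2) (θ₀ : HeckeRing0 (p ^ 2 * M) 2)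
    (hkill₀ : ∀ x : periodHomologyHecke (p ^ 2 * M), periodMapLattice (p ^ 2 * M) f x = 0 → θ₀ • x = 0)
    (w : CuspidalHomologyHeckeModule (p ^ 2 * M) k) (hw : periodClassK (p ^ 2 * M) k f w = 0) :
    hecke (p ^ 2 * M) k θ₀ w = 0 := by
  have hex := lTensor_exact k (LinearMap.exact_subtype_ker_map (periodMapLattice (p ^ 2 * M) f))
    (periodMapLattice_surjective (p ^ 2 * M) f)
  have hw' : (periodMapLattice (p ^ 2 * M) f).lTensor k w = 0 := by
    rw [← LinearMap.baseChange_eq_ltensor]; exact hw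
  obtain ⟨y, rfl⟩ := (hex w).mp hw'
  rw [hecke_eq_baseChange, LinearMap.baseChange_eq_ltensor, ← LinearMap.comp_apply, ← LinearMap.lTensor_comp]
  have h0 : heckeInt (p ^ 2 * M) θ₀ ∘ₗ (LinearMap.ker (periodMapLattice (p ^ 2 * M) f)).subtype = 0 := by
    refine LinearMap.ext fun x => ?_
    rw [LinearMap.comp_apply, Submodule.subtype_apply, heckeInt_apply, LinearMap.zero_apply]
    exact hkill₀ x x.2
  rw [h0, LinearMap.lTensor_zero, LinearMap.zero_apply]

variable [Invertible (12 : k)]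

/-- **Multiplicity one from an INTEGRAL Hecke quasi-projector**: if `θ₀ ∈ ℤ[T_q : q ≠ p] ⊂ 𝕋` kills `ker(per_f) ⊂ H₁(X₀(p²M), ℤ)`
and `per_f ∘ θ₀ = c · per_f` with `c` regular on `k ⊗ Λ_f`, then `MultOneHyp k p M hpM f`.
[cite: Shimura1971, Thm. 3.41 and Thm. 3.51; CremonaAlgorithms1997, §2.10] -/
theorem multOneHyp_of_intHeckeProjector (f : CuspForm (Gamma0 (p ^ 2 * M)) 2) {θ₀ : HeckeRing0 (p ^ 2 * M) 2}
    (hθ₀ : θ₀ ∈ Algebra.adjoin ℤ (heckeIntGenSet (p ^ 2 * M) p)) {c : ℤ}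
    (htf : ∀ x : k ⊗[ℤ] (periodLattice f).toIntSubmodule, (c : k) • x = 0 → x = 0)
    (hkill₀ : ∀ x : periodHomologyHecke (p ^ 2 * M), periodMapLattice (p ^ 2 * M) f x = 0 → θ₀ • x = 0)
    (hscale₀ : ∀ x : periodHomologyHecke (p ^ 2 * M),
      periodMapLattice (p ^ 2 * M) f (θ₀ • x) = c • periodMapLattice (p ^ 2 * M) f x) :
    MultOneHyp k p M hpM f :=
  multOneHyp_of_heckeProjector k p M hpM f (hecke_mem_adjoin_heckeGenSet k p M hθ₀) htf
    (hecke_eq_zero_of_periodClassK_eq_zero k p M f θ₀ hkill₀) (periodClassK_hecke_of_forall k p M f θ₀ c hscale₀)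

end FullLevel

end Literature.NumberTheory.ModularSymbols
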